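import Summits.BirchSwinnertonDyer.BirchSwinnertonDyer.Theorems.ResidualThetaTransportAtTwoRlfTwistedPlusCoinvOfHonda
import HarnessLib

/-!
# Input (R1) of road T / road Λ to item 23110, POINT-LEVEL half (i): the `γ`-FIXED PART of `E⁺_∞/p` is at most
# one-dimensional — `(⋃ₙ E⁺(K_n·K_v))/p` has pairwise DEPENDENT `g`-fixed classes — from the plus Honda system (CYC⁺), any
# `K`, `p`, `κ`, `ι`; at `p = 2` UNCONDITIONALLY for `GoodSS`, `a₂ = 0`

Routes `ResidualThetaTransportAtTwo` (RTT, crux r201 `ResidualLambdaFormulaNegDiscAtTwo`, stmt-BirchSwinnertonDyer-23110) /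
`ThetaPartnerAtTwo`. Seat `prover-bsd-wall-tp2-p2x-w2` g15; `--supports stmt-BirchSwinnertonDyer-23110`. THEOREMS ONLY (no definition,
no named fact, no `sorry`); route-independent; closes nothing.

WHY (lead memo RLF-TWIST-ROAD-g12 §3 (R1) «cyclicity of `(H⁺)^∨` from CYC⁺»; companion of `…PlusDualFreeRankOne` (whose hypothesis
`#S[𝔪] ≤ p` for `S = E⁺_∞ ⊗ ℚ_p/ℤ_p`, `S[𝔪] = (A/pA)^{γ}`, `A = ⋃ₙ E⁺_n`, this file supplies on points) and of `…PlusRankGrowthTwo`).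
K4 proved CYC⁺ (`SignedEC.plusCyclic_of_honda`: `E⁺_n = ℤ[Γ_{K_v}]·d + p·E⁺_n`). THIS FILE reads it as a statement about the
`g`-FIXED classes modulo `p` (`g` a local lift of the topological generator), by COUNTING in the finite group `V = E⁺_n/pE⁺_n`
with the endomorphism `N = g − 1`: every class is `k·d̄ + N(·)` (each conjugate `σ•d` is `gⁱ•d`, and `gⁱd − d = (g−1)∑_{l<i} gˡd`),
so `#V ≤ p·#N(V)`, while `#V = #ker N · #N(V)`; hence `#ker N ≤ p`, and two elements of a `p`-torsion group of order `≤ p` are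
dependent:

* §1 (abstract) `natCard_ker_le_of_cyclic_coinvariants` (`#ker N ≤ p`), `exists_dep_of_card_le` (pairwise dependence in a
  `p`-torsion subgroup of order `≤ p`).
* §2 (any `K`, `p`) `exists_pow_smul_eq_smul` (`σ•Q = gⁱ•Q` on `E(K_n·K_v)`), `exists_eq_zsmul_add_twist_of_mem_closure_orbit`,
  `exists_sum_zsmul_pow_smul_of_mem_closure_orbit` (orbit spans are `∑ cᵢ gⁱ•Q`), **`plusCoinvModP_cyclic_of_honda`** —
  `E⁺_n = ℤ·d + (g−1)E⁺_n + p·E⁺_n` (the coinvariants of `E⁺_n/p` are cyclic), **`plusFixedModP_dep_of_honda`** — for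
  `x, y ∈ E⁺_n` with `gx − x, gy − y ∈ pE⁺_n` there are `a, b ∈ ℤ`, not both `≡ 0 (mod p)`, with `ax + by ∈ pE⁺_n`;
  **`plusFixedModP_dep_iSup_of_honda`** — the same on `A = ⋃ₙ E⁺_n`.
* §3 (`K = ℚ`, `p = 2`, `W` globally minimal, `GoodSS W 2`, `a₂ = 0`, cyclotomic `κ`, `v ∋ 2`) **`plusFixedModTwo_dep_iSup_two`** —
  UNCONDITIONAL (HONDA⁺@2 is the tree theorem `PlusLayer.plusHondaSystemTwo_padic`).

HONEST FRAMING: closes nothing; 23110 is NOT proved; BSD is not proved by any of this.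
References: [Kobayashi2003] Prop. 8.12 (pp. 17–18), Thm. 6.2; [BDKim2007] Prop. 3.17; [BDKim2013] Props. 2.2–2.3; [Washington1997] §13.1–13.2.
-/

set_option autoImplicit false
-- the Theorems namespace of this sub repeats the summit name by design (D-0017 nested layout)
set_option linter.dupNamespace false

noncomputable section

open scoped Classical NumberField
open Finset

namespace Summit.BirchSwinnertonDyer.BirchSwinnertonDyer.Theorems.SignedEC.PlusModP

open Literature.NumberTheory.EllipticCurves Literature.NumberTheory.GaloisRepresentations
  WeierstrassCurve ZpExtension Literature.NumberTheory.EllipticCurves.Kobayashi2003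
  Literature.NumberTheory.EllipticCurves.Sprung2012 Summit.BirchSwinnertonDyer.Rank1Residual.Additive

universe u

/-! ## §1 Abstract counting -/

section Abstract

variable {p : ℕ} [Fact p.Prime] {V : Type*} [AddCommGroup V]

/-- **`#ker N ≤ p` when the coinvariants are cyclic.** `V` a finite abelian group, `N` an endomorphism, `v ∈ V` with `p•v = 0`
such that every `x ∈ V` is `k•v + N y`: then `#V ≤ p·#N(V)` and `#V = #ker N·#N(V)`, so `#ker N ≤ p`. [folklore] -/
theorem natCard_ker_le_of_cyclic_coinvariants [Finite V] (N : V →+ V) (v : V) (hv : p • v = 0)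
    (hgen : ∀ x : V, ∃ (k : ℤ) (y : V), x = k • v + N y) : Nat.card N.ker ≤ p := by
  have hp : p.Prime := Fact.out
  -- `#⟨v⟩ ≤ p`
  have hzv : Nat.card (AddSubgroup.zmultiples v) ≤ p := by
    rw [Nat.card_zmultiples]
    exact Nat.le_of_dvd hp.pos (addOrderOf_dvd_of_nsmul_eq_zero hv)
  -- `⟨v⟩ × N(V) ↠ V`
  have hsurj : Function.Surjective (fun ab : AddSubgroup.zmultiples v × N.range ↦ (ab.1 : V) + (ab.2 : V)) := by
    intro x
    obtain ⟨k, y, rfl⟩ := hgen x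
    exact ⟨(⟨k • v, AddSubgroup.zsmul_mem_zmultiples v k⟩, ⟨N y, ⟨y, rfl⟩⟩), rfl⟩
  have h1 : Nat.card V ≤ p * Nat.card N.range := by
    calc Nat.card V ≤ Nat.card (AddSubgroup.zmultiples v × N.range) := Nat.card_le_card_of_surjective _ hsurj
      _ = Nat.card (AddSubgroup.zmultiples v) * Nat.card N.range := Nat.card_prod _ _
      _ ≤ p * Nat.card N.range := Nat.mul_le_mul_right _ hzv
  -- `#V = #ker N · #N(V)`
  have h2 : Nat.card V = Nat.card N.range * Nat.card N.ker := by
    rw [AddSubgroup.card_eq_card_quotient_mul_card_addSubgroup N.ker,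
      Nat.card_congr (QuotientAddGroup.quotientKerEquivRange N).toEquiv]
  rw [h2, mul_comm] at h1
  exact Nat.le_of_mul_le_mul_right h1 (Nat.card_pos (α := N.range))

/-- **Two elements of a `p`-torsion subgroup of order `≤ p` are dependent**: for `s, t ∈ H` (`H` finite, `#H ≤ p`, `p·H = 0`)
there are `a, b ∈ ℤ`, not both divisible by `p`, with `a•s + b•t = 0` (if `s ≠ 0` then `ℤ·s = H` by counting). [folklore] -/
theorem exists_dep_of_card_le (H : AddSubgroup V) [Finite H] (hH : Nat.card H ≤ p) (hpH : ∀ s ∈ H, p • s = 0)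
    {s t : V} (hs : s ∈ H) (ht : t ∈ H) :
    ∃ a b : ℤ, ¬ ((p : ℤ) ∣ a ∧ (p : ℤ) ∣ b) ∧ a • s + b • t = 0 := by
  have hp : p.Prime := Fact.out
  have hp1 : ¬ (p : ℤ) ∣ 1 := by
    rw [Int.natCast_dvd_ofNat]
    exact hp.one_lt.ne' ∘ Nat.dvd_one.mp
  by_cases hs0 : s = 0
  · exact ⟨1, 0, fun h ↦ hp1 h.1, by rw [hs0, smul_zero, zero_smul, add_zero]⟩
  · have hord : addOrderOf s = p := addOrderOf_eq_prime (hpH s hs) hs0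
    have hZ : AddSubgroup.zmultiples s = H := by
      apply AddSubgroup.eq_of_le_of_card_ge (AddSubgroup.zmultiples_le_of_mem hs)
      rw [Nat.card_zmultiples, hord]
      exact hH
    have ht' : t ∈ AddSubgroup.zmultiples s := hZ ▸ ht
    obtain ⟨b, hb⟩ := AddSubgroup.mem_zmultiples_iff.mp ht'
    refine ⟨b, -1, fun h ↦ hp1 (dvd_neg.mp h.2), ?_⟩
    rw [hb, neg_one_smul, add_neg_cancel]

end Abstract

/-! ## §2 The plus points modulo `p`: cyclic coinvariants and dependent fixed classes, from the Honda system -/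

section General

variable {K : Type u} [Field K] (W : WeierstrassCurve K) {p : ℕ} [Fact p.Prime] (κ : ZpExtension K p)
  {E : Type u} [Field E] [Algebra K E] (ι : AlgebraicClosure K →ₐ[K] AlgebraicClosure E)

/-- **Each `σ ∈ Γ_{K_v}` acts on `E(K_n·K_v)` as a power `gⁱ`, `i < pⁿ`**, of a local lift `g` of the topological generator.
[cite: Washington1997, §13.1] [cite: Kobayashi2003, §2 p. 4] -/
theorem exists_pow_smul_eq_smul {g : Field.absoluteGaloisGroup E} (hg : κ.IsTopGenerator (resGalOfEmb ι g)) {n : ℕ}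
    {Q : localPoints W E} (hQ : Q ∈ localLayerPointsOfEmb κ ι W n) (σ : Field.absoluteGaloisGroup E) :
    ∃ i : ℕ, i < p ^ n ∧ σ • Q = g ^ i • Q := by
  obtain ⟨i, hi, hmem⟩ := FineSelmerLeSignedSelmer.exists_lt_pow_inv_mul_mem_layerSubgroup κ hg n (resGalOfEmb ι σ)
  have hh : (g ^ i)⁻¹ * σ ∈ localLayerSubgroupOfEmb κ ι n := by
    change _ ∈ localSubgroupOfEmb (κ.layerSubgroup n) ι
    rw [mem_localSubgroupOfEmb_iff, map_mul, map_inv, map_pow]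
    exact hmem
  refine ⟨i, hi, ?_⟩
  have hfix := (mem_localLayerPointsOfEmb_iff κ ι W n Q).1 hQ _ hh
  calc σ • Q = (g ^ i * ((g ^ i)⁻¹ * σ)) • Q := by rw [mul_inv_cancel_left]
    _ = g ^ i • Q := by rw [mul_smul, hfix]

/-- **Orbit spans modulo `g − 1` are cyclic**: for `Q ∈ E(K_n·K_v)`, every `B` in the span of the `Γ_{K_v}`-orbit of `Q` is
`c•Q + (g•Y − Y)` with `c ∈ ℤ` and `Y` in the orbit span (`σ•Q = gⁱ•Q = Q + (g−1)∑_{l<i} gˡ•Q`). [cite: Washington1997, §13.1] -/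
theorem exists_eq_zsmul_add_twist_of_mem_closure_orbit {g : Field.absoluteGaloisGroup E}
    (hg : κ.IsTopGenerator (resGalOfEmb ι g)) {n : ℕ} {Q : localPoints W E} (hQ : Q ∈ localLayerPointsOfEmb κ ι W n)
    {B : localPoints W E} (hB : B ∈ AddSubgroup.closure (Set.range fun σ : Field.absoluteGaloisGroup E ↦ σ • Q)) :
    ∃ c : ℤ, ∃ Y ∈ AddSubgroup.closure (Set.range fun σ : Field.absoluteGaloisGroup E ↦ σ • Q), B = c • Q + (g • Y - Y) := by
  induction hB using AddSubgroup.closure_induction with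
  | mem y hy =>
    obtain ⟨σ, rfl⟩ := hy
    obtain ⟨i, -, hi⟩ := exists_pow_smul_eq_smul W κ ι hg hQ σ
    refine ⟨1, ∑ l ∈ range i, g ^ l • Q, sum_pow_smul_mem_closure_orbit W g Q i, ?_⟩
    change σ • Q = _
    rw [hi, one_smul, ← pow_smul_sub_eq_smul_sub W g Q i, add_sub_cancel]
  | zero => exact ⟨0, 0, AddSubgroup.zero_mem _, by rw [zero_smul, smul_zero, sub_zero, add_zero]⟩
  | add y z _ _ hy hz =>
    obtain ⟨c₁, Y₁, hY₁, rfl⟩ := hy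
    obtain ⟨c₂, Y₂, hY₂, rfl⟩ := hz
    exact ⟨c₁ + c₂, Y₁ + Y₂, AddSubgroup.add_mem _ hY₁ hY₂, by rw [add_smul, smul_add]; abel⟩
  | neg y _ hy =>
    obtain ⟨c, Y, hY, rfl⟩ := hy
    exact ⟨-c, -Y, AddSubgroup.neg_mem _ hY, by rw [neg_smul, smul_neg]; abel⟩

/-- **Orbit spans are `∑_{i<pⁿ} cᵢ gⁱ•Q`** for `Q ∈ E(K_n·K_v)`. [cite: Washington1997, §13.1] -/
theorem exists_sum_zsmul_pow_smul_of_mem_closure_orbit {g : Field.absoluteGaloisGroup E}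
    (hg : κ.IsTopGenerator (resGalOfEmb ι g)) {n : ℕ} {Q : localPoints W E} (hQ : Q ∈ localLayerPointsOfEmb κ ι W n)
    {B : localPoints W E} (hB : B ∈ AddSubgroup.closure (Set.range fun σ : Field.absoluteGaloisGroup E ↦ σ • Q)) :
    ∃ c : Fin (p ^ n) → ℤ, B = ∑ i, c i • g ^ (i : ℕ) • Q := by
  induction hB using AddSubgroup.closure_induction with
  | mem y hy =>
    obtain ⟨σ, rfl⟩ := hy
    obtain ⟨i, hi, hσ⟩ := exists_pow_smul_eq_smul W κ ι hg hQ σ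
    refine ⟨Pi.single (⟨i, hi⟩ : Fin (p ^ n)) 1, ?_⟩
    change σ • Q = _
    rw [Finset.sum_eq_single (⟨i, hi⟩ : Fin (p ^ n)) (fun j _ hj ↦ by rw [Pi.single_eq_of_ne hj, zero_smul])
      (fun h ↦ (h (Finset.mem_univ _)).elim), Pi.single_eq_same, one_smul, hσ]
  | zero => exact ⟨0, by simp⟩
  | add y z _ _ hy hz =>
    obtain ⟨c₁, rfl⟩ := hy
    obtain ⟨c₂, rfl⟩ := hz
    exact ⟨c₁ + c₂, by rw [← Finset.sum_add_distrib]; exact Finset.sum_congr rfl fun i _ ↦ by rw [Pi.add_apply, add_smul]⟩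
  | neg y _ hy =>
    obtain ⟨c, rfl⟩ := hy
    exact ⟨-c, by rw [← Finset.sum_neg_distrib]; exact Finset.sum_congr rfl fun i _ ↦ by rw [Pi.neg_apply, neg_smul]⟩

/-- **The coinvariants of `E⁺_n/p` are cyclic**: under the plus Honda package ((NT), (IDX), (L), (TR), (GEN), (GEN₀)) and for a
local lift `g` of the topological generator, for every `n` there is `d ∈ E⁺(K_n·K_v)` such that every `x ∈ E⁺(K_n·K_v)` is
`c•d + (g•Y − Y) + p•b` with `c ∈ ℤ`, `Y, b ∈ E⁺(K_n·K_v)` — i.e. `E⁺_n/((g−1)E⁺_n + pE⁺_n)` is cyclic, generated by `d`.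
(CYC⁺ `plusCyclic_of_honda` + `exists_eq_zsmul_add_twist_of_mem_closure_orbit`.) [cite: Kobayashi2003, Prop. 8.12 (pp. 17–18)] -/
theorem plusCoinvModP_cyclic_of_honda
    (hnt : ∀ P ∈ localTowerPointsOfEmb κ ι W, p • P = 0 → P = 0)
    (hidx : ∀ m : ℕ, ((localLayerSubgroupOfEmb κ ι (m + 1)).subgroupOf (localLayerSubgroupOfEmb κ ι m)).index = p)
    {g : Field.absoluteGaloisGroup E} (hg : κ.IsTopGenerator (resGalOfEmb ι g))
    (d : ℕ → localPoints W E) (hd : ∀ m, d m ∈ localLayerPointsOfEmb κ ι W m)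
    (htr : ∀ m, localTraceOfEmb κ ι W (m + 1) (m + 2) (d (m + 2)) = -d m)
    (hgen : ∀ m : ℕ, 1 ≤ m → ∀ P ∈ localLayerPointsOfEmb κ ι W m,
      ∃ B ∈ AddSubgroup.closure (Set.range fun σ : Field.absoluteGaloisGroup E ↦ σ • d m),
        ∃ P' ∈ localLayerPointsOfEmb κ ι W (m - 1), ∃ R ∈ localLayerPointsOfEmb κ ι W m, P = B + P' + p • R)
    (hgen0 : ∀ P ∈ localLayerPointsOfEmb κ ι W 0, ∃ a : ℤ, ∃ R ∈ localLayerPointsOfEmb κ ι W 0, P = a • d 0 + p • R)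
    (n : ℕ) :
    ∃ dd ∈ signedLocalPointsOfEmb κ ι W 1 n, ∀ x ∈ signedLocalPointsOfEmb κ ι W 1 n,
      ∃ c : ℤ, ∃ Y ∈ signedLocalPointsOfEmb κ ι W 1 n, ∃ b ∈ signedLocalPointsOfEmb κ ι W 1 n,
        x = c • dd + (g • Y - Y) + p • b := by
  obtain ⟨dd, hdd, hcyc⟩ := plusCyclic_of_honda W κ ι hnt hidx d hd htr hgen hgen0 n
  have hddM : dd ∈ localLayerPointsOfEmb κ ι W n := ((mem_signedLocalPointsOfEmb_iff κ ι W 1 n dd).1 hdd).1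
  refine ⟨dd, hdd, fun x hx ↦ ?_⟩
  obtain ⟨B, hB, b, hb, hxe⟩ := hcyc x hx
  obtain ⟨c, Y, hY, hBe⟩ := exists_eq_zsmul_add_twist_of_mem_closure_orbit W κ ι hg hddM hB
  exact ⟨c, Y, closure_orbit_le_signedLocalPointsOfEmb W κ ι 1 n hdd hY, b, hb, by rw [hxe, hBe]⟩

/-- **The `g`-fixed classes of `E⁺_n/pE⁺_n` are pairwise dependent** (`(E⁺_n/p)^{γ}` has at most `p` elements): under the plus Honda
package, for `x, y ∈ E⁺(K_n·K_v)` with `g•x − x, g•y − y ∈ p·E⁺(K_n·K_v)` there are `a, b ∈ ℤ`, not both divisible by `p`, and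
`w ∈ E⁺(K_n·K_v)` with `a•x + b•y = p•w`. (Counting in `V = E⁺_n/pE⁺_n`, finite — spanned by the classes of `gⁱ•d`, `i < pⁿ` — with
`N = g − 1`: `#ker N ≤ p` by `natCard_ker_le_of_cyclic_coinvariants`, then `exists_dep_of_card_le`.)
[cite: Kobayashi2003, Prop. 8.12 (pp. 17–18)] [cite: BDKim2007, Prop. 3.17] -/
theorem plusFixedModP_dep_of_honda
    (hnt : ∀ P ∈ localTowerPointsOfEmb κ ι W, p • P = 0 → P = 0)
    (hidx : ∀ m : ℕ, ((localLayerSubgroupOfEmb κ ι (m + 1)).subgroupOf (localLayerSubgroupOfEmb κ ι m)).index = p)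
    {g : Field.absoluteGaloisGroup E} (hg : κ.IsTopGenerator (resGalOfEmb ι g))
    (d : ℕ → localPoints W E) (hd : ∀ m, d m ∈ localLayerPointsOfEmb κ ι W m)
    (htr : ∀ m, localTraceOfEmb κ ι W (m + 1) (m + 2) (d (m + 2)) = -d m)
    (hgen : ∀ m : ℕ, 1 ≤ m → ∀ P ∈ localLayerPointsOfEmb κ ι W m,
      ∃ B ∈ AddSubgroup.closure (Set.range fun σ : Field.absoluteGaloisGroup E ↦ σ • d m),
        ∃ P' ∈ localLayerPointsOfEmb κ ι W (m - 1), ∃ R ∈ localLayerPointsOfEmb κ ι W m, P = B + P' + p • R)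
    (hgen0 : ∀ P ∈ localLayerPointsOfEmb κ ι W 0, ∃ a : ℤ, ∃ R ∈ localLayerPointsOfEmb κ ι W 0, P = a • d 0 + p • R)
    (n : ℕ) :
    ∀ x ∈ signedLocalPointsOfEmb κ ι W 1 n, ∀ y ∈ signedLocalPointsOfEmb κ ι W 1 n,
      (∃ w ∈ signedLocalPointsOfEmb κ ι W 1 n, g • x - x = p • w) →
      (∃ w ∈ signedLocalPointsOfEmb κ ι W 1 n, g • y - y = p • w) →
      ∃ a b : ℤ, ¬ ((p : ℤ) ∣ a ∧ (p : ℤ) ∣ b) ∧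
        ∃ w ∈ signedLocalPointsOfEmb κ ι W 1 n, a • x + b • y = p • w := by
  have hp : p.Prime := Fact.out
  haveI : NeZero p := ⟨hp.ne_zero⟩
  intro x hx y hy hxfix hyfix
  set L := signedLocalPointsOfEmb κ ι W 1 n with hLdef
  have hstab : ∀ (σ : Field.absoluteGaloisGroup E), ∀ a ∈ L, σ • a ∈ L := by
    intro σ a ha
    rw [hLdef, signedLocalPointsOfEmb_eq_towerSigned] at ha ⊢
    exact smul_mem_towerSignedLocalPointsOfEmb κ.layerSubgroup ι W 1 n σ ha
  -- the generator of the coinvariants and the finite spanning family `gⁱ•dd`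
  obtain ⟨dd, hdd, hcoinv⟩ := plusCoinvModP_cyclic_of_honda W κ ι hnt hidx hg d hd htr hgen hgen0 n
  obtain ⟨dd', hdd', hcyc⟩ := plusCyclic_of_honda W κ ι hnt hidx d hd htr hgen hgen0 n
  have hdd'M : dd' ∈ localLayerPointsOfEmb κ ι W n := ((mem_signedLocalPointsOfEmb_iff κ ι W 1 n dd').1 hdd').1
  have hpow : ∀ i : ℕ, g ^ i • dd' ∈ L := by
    intro i
    induction i with
    | zero => simpa using hdd'
    | succ i ih => rw [pow_succ', mul_smul]; exact hstab g _ ih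
  -- `V = L / pL`, `N = g − 1`
  let P : AddSubgroup L := (DistribSMul.toAddMonoidHom L p).range
  have hPmem : ∀ w : L, p • w ∈ P := fun w ↦ ⟨w, rfl⟩
  let φ : L →+ L :=
    { toFun := fun a ↦ ⟨g • (a : localPoints W E) - a, L.sub_mem (hstab g a a.2) a.2⟩
      map_zero' := Subtype.ext (by simp)
      map_add' := fun a b ↦ Subtype.ext (by simp only [AddSubgroup.coe_add, smul_add, AddMemClass.mk_add_mk]; abel) }
  have hφ : ∀ a : L, ((φ a : L) : localPoints W E) = g • (a : localPoints W E) - a := fun _ ↦ rfl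
  have hPφ : P ≤ P.comap φ := by
    rintro _ ⟨w, rfl⟩
    refine ⟨φ w, ?_⟩
    simp only [DistribSMul.toAddMonoidHom_apply, map_nsmul]
  let N : L ⧸ P →+ L ⧸ P := QuotientAddGroup.map P P φ hPφ
  have hN : ∀ a : L, N (a : L ⧸ P) = ((φ a : L) : L ⧸ P) := fun a ↦ QuotientAddGroup.map_mk P P φ hPφ a
  have hmk0 : ∀ a : L, ((a : L ⧸ P) = 0) ↔ ∃ w : L, p • w = a := by
    intro a
    rw [QuotientAddGroup.eq_zero_iff]
    exact ⟨fun ⟨w, hw⟩ ↦ ⟨w, hw⟩, fun ⟨w, hw⟩ ↦ ⟨w, hw⟩⟩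
  have hpV : ∀ X : L ⧸ P, p • X = 0 := by
    intro X
    obtain ⟨a, rfl⟩ := QuotientAddGroup.mk_surjective X
    rw [← QuotientAddGroup.mk_nsmul, hmk0]
    exact ⟨a, rfl⟩
  -- `V` is finite: spanned by the classes of `gⁱ•dd'`, `i < pⁿ`, with coefficients mod `p`
  haveI : Finite (L ⧸ P) := by
    refine Finite.of_surjective (fun c : Fin (p ^ n) → ZMod p ↦
      ∑ i, ((c i).val : ℤ) • ((⟨g ^ (i : ℕ) • dd', hpow i⟩ : L) : L ⧸ P)) fun X ↦ ?_
    obtain ⟨a, rfl⟩ := QuotientAddGroup.mk_surjective X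
    obtain ⟨B, hB, b, hb, hae⟩ := hcyc a a.2
    obtain ⟨c, hBe⟩ := exists_sum_zsmul_pow_smul_of_mem_closure_orbit W κ ι hg hdd'M hB
    refine ⟨fun i ↦ (c i : ZMod p), ?_⟩
    have hmod : ∀ (i : Fin (p ^ n)) (X : L ⧸ P), (((c i : ZMod p)).val : ℤ) • X = c i • X := by
      intro i X
      rw [ZMod.val_intCast]
      conv_rhs => rw [← Int.emod_add_mul_ediv (c i) p, add_zsmul, mul_zsmul, natCast_zsmul, hpV, add_zero]
    simp only [hmod]
    have ha' : a = (∑ i, c i • (⟨g ^ (i : ℕ) • dd', hpow i⟩ : L)) + p • (⟨b, hb⟩ : L) :=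
      Subtype.ext (by simp only [AddSubgroup.coe_add, AddSubgroup.val_finsetSum, AddSubgroup.coe_zsmul,
        AddSubgroup.coe_nsmul]; rw [hae, hBe])
    rw [ha', QuotientAddGroup.mk_add, QuotientAddGroup.mk_nsmul, hpV, add_zero, QuotientAddGroup.mk_sum]
    exact Finset.sum_congr rfl fun i _ ↦ by rw [QuotientAddGroup.mk_zsmul]
  -- cyclic coinvariants in `V`
  have hgenV : ∀ X : L ⧸ P, ∃ (k : ℤ) (Y : L ⧸ P), X = k • ((⟨dd, hdd⟩ : L) : L ⧸ P) + N Y := by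
    intro X
    obtain ⟨a, rfl⟩ := QuotientAddGroup.mk_surjective X
    obtain ⟨c, Y, hY, b, hb, hae⟩ := hcoinv a a.2
    refine ⟨c, ((⟨Y, hY⟩ : L) : L ⧸ P), ?_⟩
    rw [hN, ← QuotientAddGroup.mk_zsmul, ← QuotientAddGroup.mk_add]
    have ha' : a = c • (⟨dd, hdd⟩ : L) + φ ⟨Y, hY⟩ + p • (⟨b, hb⟩ : L) :=
      Subtype.ext (by simp only [AddSubgroup.coe_add, AddSubgroup.coe_zsmul, AddSubgroup.coe_nsmul, hφ]; exact hae)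
    rw [ha', QuotientAddGroup.mk_add, QuotientAddGroup.mk_nsmul, hpV, add_zero]
  have hcard : Nat.card N.ker ≤ p :=
    natCard_ker_le_of_cyclic_coinvariants N _ (hpV _) hgenV
  -- the two fixed classes lie in `ker N`
  have hker : ∀ {z : localPoints W E} (hz : z ∈ L), (∃ w ∈ L, g • z - z = p • w) → ((⟨z, hz⟩ : L) : L ⧸ P) ∈ N.ker := by
    intro z hz ⟨w, hw, hzw⟩
    rw [AddMonoidHom.mem_ker, hN, hmk0]
    exact ⟨⟨w, hw⟩, Subtype.ext (by rw [AddSubgroup.coe_nsmul, hφ]; exact hzw.symm)⟩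
  haveI : Finite N.ker := inferInstance
  obtain ⟨a, b, hab, hrel⟩ := exists_dep_of_card_le N.ker hcard (fun s _ ↦ hpV s) (hker hx hxfix) (hker hy hyfix)
  refine ⟨a, b, hab, ?_⟩
  rw [← QuotientAddGroup.mk_zsmul, ← QuotientAddGroup.mk_zsmul, ← QuotientAddGroup.mk_add, hmk0] at hrel
  obtain ⟨w, hw⟩ := hrel
  refine ⟨w, w.2, ?_⟩
  have := congrArg (fun t : L ↦ (t : localPoints W E)) hw
  simp only [AddSubgroup.coe_nsmul, AddSubgroup.coe_add, AddSubgroup.coe_zsmul] at this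
  exact this.symm

/-- **The `g`-fixed classes of `(⋃ₙ E⁺_n)/p` are pairwise dependent**: under the plus Honda package, for `x, y ∈ A = ⋃ₙ E⁺(K_n·K_v)`
with `g•x − x, g•y − y ∈ p·A` there are `a, b ∈ ℤ`, not both divisible by `p`, and `w ∈ A` with `a•x + b•y = p•w` — i.e. the
`γ`-fixed part of `A/pA = (A ⊗ ℚ_p/ℤ_p)[p]` has at most `p` elements: the hypothesis `#S[𝔪] ≤ p` of `…PlusDualFreeRankOne`.
[cite: Kobayashi2003, Prop. 8.12] [cite: BDKim2007, Prop. 3.17] -/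
theorem plusFixedModP_dep_iSup_of_honda
    (hnt : ∀ P ∈ localTowerPointsOfEmb κ ι W, p • P = 0 → P = 0)
    (hidx : ∀ m : ℕ, ((localLayerSubgroupOfEmb κ ι (m + 1)).subgroupOf (localLayerSubgroupOfEmb κ ι m)).index = p)
    {g : Field.absoluteGaloisGroup E} (hg : κ.IsTopGenerator (resGalOfEmb ι g))
    (d : ℕ → localPoints W E) (hd : ∀ m, d m ∈ localLayerPointsOfEmb κ ι W m)
    (htr : ∀ m, localTraceOfEmb κ ι W (m + 1) (m + 2) (d (m + 2)) = -d m)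
    (hgen : ∀ m : ℕ, 1 ≤ m → ∀ P ∈ localLayerPointsOfEmb κ ι W m,
      ∃ B ∈ AddSubgroup.closure (Set.range fun σ : Field.absoluteGaloisGroup E ↦ σ • d m),
        ∃ P' ∈ localLayerPointsOfEmb κ ι W (m - 1), ∃ R ∈ localLayerPointsOfEmb κ ι W m, P = B + P' + p • R)
    (hgen0 : ∀ P ∈ localLayerPointsOfEmb κ ι W 0, ∃ a : ℤ, ∃ R ∈ localLayerPointsOfEmb κ ι W 0, P = a • d 0 + p • R) :
    ∀ x ∈ (⨆ n, signedLocalPointsOfEmb κ ι W 1 n), ∀ y ∈ (⨆ n, signedLocalPointsOfEmb κ ι W 1 n),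
      (∃ w ∈ (⨆ n, signedLocalPointsOfEmb κ ι W 1 n), g • x - x = p • w) →
      (∃ w ∈ (⨆ n, signedLocalPointsOfEmb κ ι W 1 n), g • y - y = p • w) →
      ∃ a b : ℤ, ¬ ((p : ℤ) ∣ a ∧ (p : ℤ) ∣ b) ∧
        ∃ w ∈ (⨆ n, signedLocalPointsOfEmb κ ι W 1 n), a • x + b • y = p • w := by
  intro x hx y hy ⟨wx, hwx, hxe⟩ ⟨wy, hwy, hye⟩
  have hdir := (signedLocalPointsOfEmb_mono κ ι W 1).directed_le
  obtain ⟨n₁, hx₁⟩ := (AddSubgroup.mem_iSup_of_directed hdir).1 hx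
  obtain ⟨n₂, hy₂⟩ := (AddSubgroup.mem_iSup_of_directed hdir).1 hy
  obtain ⟨n₃, hwx₃⟩ := (AddSubgroup.mem_iSup_of_directed hdir).1 hwx
  obtain ⟨n₄, hwy₄⟩ := (AddSubgroup.mem_iSup_of_directed hdir).1 hwy
  set n := n₁ + n₂ + n₃ + n₄ with hn
  have hmono := signedLocalPointsOfEmb_mono κ ι W 1
  obtain ⟨a, b, hab, w, hw, hrel⟩ := plusFixedModP_dep_of_honda W κ ι hnt hidx hg d hd htr hgen hgen0 n
    x (hmono (by omega : n₁ ≤ n) hx₁) y (hmono (by omega : n₂ ≤ n) hy₂)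
    ⟨wx, hmono (by omega : n₃ ≤ n) hwx₃, hxe⟩ ⟨wy, hmono (by omega : n₄ ≤ n) hwy₄, hye⟩
  exact ⟨a, b, hab, w, le_iSup (fun m ↦ signedLocalPointsOfEmb κ ι W 1 m) n hw, hrel⟩

end General

/-! ## §3 `K = ℚ`, `p = 2`: unconditionally for `GoodSS W 2`, `a₂ = 0` -/

section Two

open NumberField IsDedekindDomain

variable (W : WeierstrassCurve ℚ) [W.IsElliptic] [W.IsGloballyMinimal]

/-- **The `γ`-fixed part of `(⋃ₙ E⁺(ℚ_{2,n}))/2` has at most two classes, unconditionally.** For `W/ℚ` globally minimal with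
good supersingular reduction at `2` and `a₂(W) = 0`, the cyclotomic `ℤ₂`-extension `κ`, the place `v ∋ 2` and a local
`g ∈ Γ_{ℚ_v}` restricting to a topological generator: for `x, y ∈ A = ⋃ₙ E⁺(ℚ_{2,n})` with `g•x − x, g•y − y ∈ 2A` there are
`a, b ∈ ℤ`, not both even, and `w ∈ A` with `a•x + b•y = 2•w`. The plus Honda system is the tree theorem HONDA⁺@2
(`PlusLayer.plusHondaSystemTwo_padic`, transported by `plusHondaSystem_adicCompletion_of_padic_nonDiv`); (NT), (IDX) as in
`plusCoinvPair_two_of_honda`. [cite: Kobayashi2003, Prop. 8.12, Thm. 6.2] [cite: BDKim2007, Prop. 3.17] [cite: Sprung2012, Thm. 2.2] -/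
theorem plusFixedModTwo_dep_iSup_two (hss : Rank1Residual.GoodSS W 2) (ha : W.frobeniusTrace 2 = 0) {κ : ZpExtension ℚ 2}
    (hκ : κ.IsCyclotomic) (v : HeightOneSpectrum (𝓞 ℚ)) (hv : (2 : 𝓞 ℚ) ∈ v.asIdeal)
    {g : Field.absoluteGaloisGroup (v.adicCompletion ℚ)}
    (hg : κ.IsTopGenerator (resGalOfEmb (closureEmb (K := ℚ) (v.adicCompletion ℚ)) g)) :
    ∀ x ∈ (⨆ n, signedLocalPoints κ (v.adicCompletion ℚ) W 1 n), ∀ y ∈ (⨆ n, signedLocalPoints κ (v.adicCompletion ℚ) W 1 n),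
      (∃ w ∈ (⨆ n, signedLocalPoints κ (v.adicCompletion ℚ) W 1 n), g • x - x = 2 • w) →
      (∃ w ∈ (⨆ n, signedLocalPoints κ (v.adicCompletion ℚ) W 1 n), g • y - y = 2 • w) →
      ∃ a b : ℤ, ¬ ((2 : ℤ) ∣ a ∧ (2 : ℤ) ∣ b) ∧
        ∃ w ∈ (⨆ n, signedLocalPoints κ (v.adicCompletion ℚ) W 1 n), a • x + b • y = 2 • w := by
  have hnt : ∀ P ∈ localTowerPointsOfEmb κ (closureEmb (K := ℚ) (v.adicCompletion ℚ)) W, 2 • P = 0 → P = 0 :=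
    fun P hP h2 ↦ SSFlatEC.eq_zero_of_mem_localTowerPointsOfEmb_of_two_nsmul W hss κ (by exact_mod_cast hv) _ hP h2
  have hidx := index_subgroupOf_localLayerSubgroupOfEmb_succ_eq (p := 2) hκ v (by exact_mod_cast hv)
  obtain ⟨d, hd, htr, hgen, hgen0⟩ := plusHondaSystem_adicCompletion_of_padic_nonDiv W hss κ v hv
    fun ι ↦ PlusLayer.plusHondaSystemTwo_padic W hss ha κ hκ ι
  have h := plusFixedModP_dep_iSup_of_honda W κ (closureEmb (K := ℚ) (v.adicCompletion ℚ)) hnt hidx hg d hd htr hgen hgen0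
  exact_mod_cast h

end Two

end Summit.BirchSwinnertonDyer.BirchSwinnertonDyer.Theorems.SignedEC.PlusModP

end
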